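import Summits.BirchSwinnertonDyer.BirchSwinnertonDyer.Theorems.ByReductionTypeAtTwoRankOneAtTwoBigImageOddLocalOneDoorHalvesKNamed
import Summits.BirchSwinnertonDyer.BirchSwinnertonDyer.Theorems.ByReductionTypeAtTwoRankOneAtTwoBigImageOddLocalOneDoorPairParity
import Summits.BirchSwinnertonDyer.BirchSwinnertonDyer.Theorems.SchneiderFreeUpperSockets
import Literature.NumberTheory.EllipticCurves.Rank1Residual.Typed.JointLower
import HarnessLib

/-!
# Route ByReductionTypeAtTwo, crux `RankOneAtTwoBigImageOddLocal` (stmt-BirchSwinnertonDyer-23715), LINE v8.6 `one_door_analytic`: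
# per door datum, PRINT only — U's inequality IS the joint upper half of the pair, the c-corrected K-binder IS the upper half over `K`

Width prover seat `bsd-line-fkl-p2` g9 (2026-08-28), `--supports stmt-BirchSwinnertonDyer-23715`.  THEOREMS ONLY; nothing is asserted;
BSD is not proved by any of this.  Companion of `…OneDoorHalvesJoint.lean` (the defect additivity `def(W_K) = def(W) + def(Wd)` and the
crossings, any prime); this file is the `p = 2` dictionary at ONE door datum, with NO `BSD₂(Wd)` and NO `S_rankZeroTwin` input anywhere:

* §2 E-side (`jointUpperBoundAt_two_iff_doorLawGeC_at`, `jointLowerBoundAt_two_iff_doorLawLeC_at`): for `W` on the slice (odd torsion, odd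
  Tamagawa, analytic rank `1`), a door-admissible `K` with `L(W^{(d_K)},1) ≠ 0`, ANY datum `Dt`, the Heegner point `P` and a globally
  minimal twin `Wd`, AN-28c-U's conclusion `s_E + s_d + t + 2s + 2·v₂(c) ≤ 2m + [Δ_W<0]` (for every exponent `m` of `P`) is EQUIVALENT to
  `SchneiderFree.Upper.JointUpperBoundAt W Wd 2` (`ord₂ #Ш(W) + ord₂ #Ш(Wd) ≤ ord₂ #Ш_an(W) + ord₂ #Ш_an(Wd)`), and AN-28c-L's to
  `Typed.JointLowerBoundAt W Wd 2` — by the predecessor's PRINT-only pair ledger `pairShaAnLedger_at` (p630299: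
  `ord₂ #Ш_an(W) + ord₂ #Ш_an(Wd) + t + 2s = 2m + [Δ_W<0] − 2·v₂(c)`, Gross–Zagier + Kolyvagin + modularity + the proved twist Tamagawa law).
* §3 K-side (`upperOverC_baseChange_two_iff_shaUpperC_at`, `lowerOverC_…`): at a conductor-`1` Kolyvagin–Heegner datum with exact exponent
  `M₀`, the c-corrected binder `ord₂ #Ш(E_K)[2^∞] + 2·v₂(c) ≤ 2·M₀` (g8's `hXU`) is EQUIVALENT to `AdditivePotMult.MissingUpperBoundOverCAt
  (W ⊗ K) 2`, and `≥` to `MissingLowerBoundOverCAt` (`ord₂ #Ш_an(W ⊗ K) = 2·M₀ − 2·v₂(c)`, p626702).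
* §4 `kolyvaginAdmissible_of_doorAdmissible` (a door-admissible `d_K` is odd, `≠ −3`, with `d_K·(−|Δ|)`, `d_K·(−2|Δ|)` non-squares — route
  GenusKolyvaginAtTwo's binders) and `exists_kolyvaginDatum_at_door` (every door of a rank-one curve carries a conductor-`1` datum with
  `y_K` of infinite order and an exact exponent `M₀`, for any given `Dt`, `ι`).

With `…OneDoorHalvesJoint.lean` (§1: `MissingUpperBoundOverCAt ⟺ JointUpperBoundAt`), the chain «hXU at a K-datum ⟺ upper over `K` ⟺
joint upper of the pair ⟺ U at every E-datum of the same door» is PRINT-only end to end (sequel `…OneDoorHalvesJointSlice.lean`).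

References: [GrossZagier1986] Thm. I.6.3, V.§2; [GrossLMS1991] Thm. 1.3, §2 Conj. (2.2), §4; [McCallumLMS1991] §5 Lemma 5.1;
[Kramer1981] Prop. 3; [Miller2011LMS] Def. 1.1; [SilvermanAEC2009] VII.5 Prop. 5.1; [Darmon2004] Thm. 3.6.
-/

set_option autoImplicit false
-- the Theorems namespace of this sub repeats the summit name by design (D-0017 nested layout)
set_option linter.dupNamespace false

noncomputable section

open scoped Classical

namespace Summit.BirchSwinnertonDyer.BirchSwinnertonDyer.Theorems.RankOneAtTwoOneDoor

open WeierstrassCurve NumberField Literature.NumberTheory.EllipticCurves Literature.NumberTheory.EllipticCurves.ModularForms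
  Literature.NumberTheory.EllipticCurves.Rank1Residual
  Literature.NumberTheory.EllipticCurves.Rank1Residual.Typed
  Literature.NumberTheory.EllipticCurves.KrizLi2019
  Summit.BirchSwinnertonDyer.Rank1Residual
  Summit.BirchSwinnertonDyer.Rank1Residual.AdditivePotMult
  Summit.BirchSwinnertonDyer.Rank1Residual.F1Sign2
  Summit.BirchSwinnertonDyer.Rank1Residual.F1Sign2.TranspositionDoor
  Summit.BirchSwinnertonDyer.BirchSwinnertonDyer.Theses.ByReductionTypeAtTwo
  Summit.BirchSwinnertonDyer.BirchSwinnertonDyer.Theorems.CMExactDescent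
  Summit.BirchSwinnertonDyer.BirchSwinnertonDyer.Theorems.SchneiderFree.Upper

/-! ### §2 `p = 2`, E-side, per door datum, PRINT only: U's inequality IS the joint upper half, L's IS the joint lower half -/

section ESide

variable (W : WeierstrassCurve ℚ) [W.IsElliptic] [W.IsGloballyMinimal] [NeZero (W.conductorNorm ℤ)]
  (hT : Odd W.torsionOrder) (hc : Odd W.tamagawaProduct) (hr : W.analyticRank = 1)
  (K : Type) [Field K] [NumberField K] (hK : IsImaginaryQuadratic K)
  (hGZ : gross_zagier (W.conductorNorm ℤ) W K) (hKo : kolyvagin (W.conductorNorm ℤ) W K)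
  (hadm : DoorAdmissible W (NumberField.discr K))
  (hLt : (W.quadraticTwist (NumberField.discr K : ℚ)).entireLFunction 1 ≠ 0)
  (Dt : ModularParametrizationData W (W.conductorNorm ℤ))
  (H : HeegnerDatum (W.conductorNorm ℤ) (NumberField.discr K)) (ι : K →+* ℂ)
  (P : (W.baseChange K).toAffine.Point)
  (hP : WeierstrassCurve.Affine.Point.map ι.toRatAlgHom P = heegnerPointComplex Dt H)
  (Wd : WeierstrassCurve ℚ) [Wd.IsElliptic] [Wd.IsGloballyMinimal] (Cd : VariableChange ℚ)
  (hWd : Cd • W.quadraticTwist (NumberField.discr K : ℚ) = Wd)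
  (hnf : exists_isNewformOf) (hGZK : rank_eq_analyticRank_of_analyticRank_le_one)

include hT hc hr hK hGZ hKo hadm hLt hP hWd hnf hGZK

/-- The PRINT-only opening at a door datum: `rank E(ℚ) = 1`, the Heegner hypothesis, `Ш(W)` and `Ш(Wd)` finite, `r_an(Wd) = 0`, an
exponent of `P` exists, and rational values `q`, `q'` of `#Ш_an(W)`, `#Ш_an(Wd)` with the pair ledger
`ord₂ q + ord₂ q' + t + 2s = 2m + [Δ_W<0] − 2·v₂(c)` at every exponent `m` (`pairShaAnLedger_at`, p630299).
[cite: GrossZagier1986, Thm. I.6.3 and V.§2] [cite: Kramer1981, Prop. 3] -/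
theorem doorPairLedger_package_at :
    Finite W.sha ∧ Finite Wd.sha ∧ Wd.analyticRank = 0 ∧ (∃ m : ℕ, HasTwoDivisibilityUpToTorsion W K P m) ∧
      ∃ q q' : ℚ, shaAn W = (q : ℂ) ∧ shaAn Wd = (q' : ℂ) ∧
        ∀ m : ℕ, HasTwoDivisibilityUpToTorsion W K P m →
          padicValRat 2 q + padicValRat 2 q' + (transpCount W (NumberField.discr K) : ℤ) +
              2 * (identCount W (NumberField.discr K) : ℤ) =
            2 * (m : ℤ) + ((if W.Δ < 0 then 1 else 0 : ℕ) : ℤ) - 2 * (padicValInt 2 Dt.c : ℤ) := by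
  have hmod : hasEntireLFunction_rat := hasEntireLFunction_rat_of_exists_isNewformOf hnf
  obtain ⟨hrkW, hfinW⟩ := hGZK W hr.le
  have hrQ : W.mordellWeilRank = 1 := by rw [hrkW, hr]
  have hHN : SatisfiesHeegnerHypothesis (W.conductorNorm ℤ) K := satisfiesHeegnerHypothesis_of_doorAdmissible W K hK hadm
  obtain ⟨-, hexm, q, q', hq, hq', -, -, hval⟩ :=
    pairShaAnLedger_at hnf W hT hc hr hrQ K hK hGZ hKo hadm hHN hLt Dt H ι P hP Wd Cd hWd
  have hD0 : (NumberField.discr K : ℚ) ≠ 0 := by exact_mod_cast NumberField.discr_ne_zero K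
  haveI hEt : (W.quadraticTwist (NumberField.discr K : ℚ)).IsElliptic := W.isElliptic_quadraticTwist hD0
  have hLeq : Wd.entireLFunction = (W.quadraticTwist (NumberField.discr K : ℚ)).entireLFunction := by
    rw [← hWd, entireLFunction_smul]
  have hLd : Wd.entireLFunction 1 ≠ 0 := by rw [hLeq]; exact hLt
  have hrd : Wd.analyticRank = 0 := (Wd.analyticRank_eq_zero_iff_holds (hmod Wd)).2 hLd
  obtain ⟨-, hfinD⟩ := hGZK Wd (by rw [hrd]; exact zero_le_one)
  exact ⟨hfinW, hfinD, hrd, hexm, q, q', hq, hq', hval⟩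

/-- **U's inequality at a door datum IS the JOINT UPPER half of the pair, PRINT only.**  For `W` on the slice (odd torsion, odd
Tamagawa, analytic rank `1`), a door-admissible `K` with `L(W^{(d_K)},1) ≠ 0`, ANY datum `Dt`, the Heegner point `P`, a globally minimal
twin `Wd`; modulo Gross–Zagier / Kolyvagin at `(N_E, W, K)`, GZK and modularity as a newform:
`SchneiderFree.Upper.JointUpperBoundAt W Wd 2` (`ord₂ #Ш(W) + ord₂ #Ш(Wd) ≤ ord₂ #Ш_an(W) + ord₂ #Ш_an(Wd)`) holds iff for every exact
`2`-divisibility exponent `m` of `P`, `s_E + s_d + t + 2s + 2·v₂(c) ≤ 2m + [Δ_W<0]` — AN-28c-U's conclusion at this datum.  NO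
`BSD₂(Wd)` input (compare `missingUpperBoundAt_two_iff_doorLawGeC_at`, p627273, which needs it).
[cite: GrossZagier1986, Thm. I.6.3 and V.§2] [cite: GrossLMS1991, §2 Conj. (2.2)] [cite: Miller2011LMS, Def. 1.1] -/
theorem jointUpperBoundAt_two_iff_doorLawGeC_at :
    JointUpperBoundAt W Wd 2 ↔
      ∀ m : ℕ, HasTwoDivisibilityUpToTorsion W K P m →
        padicValNat 2 (Nat.card (AddCommGroup.primaryComponent W.sha 2)) +
            padicValNat 2 (Nat.card (AddCommGroup.primaryComponent Wd.sha 2)) +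
            transpCount W (NumberField.discr K) + 2 * identCount W (NumberField.discr K) + 2 * padicValInt 2 Dt.c ≤
          2 * m + (if W.Δ < 0 then 1 else 0) := by
  haveI : Fact (Nat.Prime 2) := ⟨Nat.prime_two⟩
  obtain ⟨hfinW, hfinD, -, ⟨m₀, hm₀⟩, q, q', hq, hq', hval⟩ :=
    doorPairLedger_package_at W hT hc hr K hK hGZ hKo hadm hLt Dt H ι P hP Wd Cd hWd hnf hGZK
  haveI := hfinW
  haveI := hfinD
  have hsW : padicValNat 2 W.shaOrder = padicValNat 2 (Nat.card (AddCommGroup.primaryComponent W.sha 2)) :=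
    X11b.Three.Koly.padicValNat_shaOrder_eq W 2
  have hsD : padicValNat 2 Wd.shaOrder = padicValNat 2 (Nat.card (AddCommGroup.primaryComponent Wd.sha 2)) :=
    X11b.Three.Koly.padicValNat_shaOrder_eq Wd 2
  set e : ℕ := (if W.Δ < 0 then 1 else 0 : ℕ) with he_def
  constructor
  · rintro ⟨q₁, q₁', hq₁, hq₁', hle⟩ m hm
    have h1 : q₁ = q := by
      have : ((q₁ : ℂ)) = (q : ℂ) := by rw [← hq₁, hq]
      exact_mod_cast this
    have h2 : q₁' = q' := by
      have : ((q₁' : ℂ)) = (q' : ℂ) := by rw [← hq₁', hq']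
      exact_mod_cast this
    subst h1 h2
    have hv := hval m hm
    rw [hsW, hsD] at hle
    rw [← Nat.cast_le (α := ℤ)]
    push_cast at hle ⊢
    linarith
  · intro h
    refine ⟨q, q', hq, hq', ?_⟩
    have hv := hval m₀ hm₀
    have hineqZ := (Nat.cast_le (α := ℤ)).mpr (h m₀ hm₀)
    rw [hsW, hsD]
    push_cast at hineqZ ⊢
    linarith

/-- **L's inequality at a door datum IS the JOINT LOWER half of the pair, PRINT only** (`Typed.JointLowerBoundAt W Wd 2` ⟺ for every
exponent `m`, `2m + [Δ_W<0] ≤ s_E + s_d + t + 2s + 2·v₂(c)`), same setting, no `BSD₂(Wd)` input.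
[cite: GrossZagier1986, Thm. I.6.3 and V.§2] [cite: GrossLMS1991, §2 Conj. (2.2)] [cite: Miller2011LMS, Def. 1.1] -/
theorem jointLowerBoundAt_two_iff_doorLawLeC_at :
    JointLowerBoundAt W Wd 2 ↔
      ∀ m : ℕ, HasTwoDivisibilityUpToTorsion W K P m →
        2 * m + (if W.Δ < 0 then 1 else 0) ≤
          padicValNat 2 (Nat.card (AddCommGroup.primaryComponent W.sha 2)) +
            padicValNat 2 (Nat.card (AddCommGroup.primaryComponent Wd.sha 2)) +
            transpCount W (NumberField.discr K) + 2 * identCount W (NumberField.discr K) + 2 * padicValInt 2 Dt.c := by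
  haveI : Fact (Nat.Prime 2) := ⟨Nat.prime_two⟩
  obtain ⟨hfinW, hfinD, -, ⟨m₀, hm₀⟩, q, q', hq, hq', hval⟩ :=
    doorPairLedger_package_at W hT hc hr K hK hGZ hKo hadm hLt Dt H ι P hP Wd Cd hWd hnf hGZK
  haveI := hfinW
  haveI := hfinD
  have hsW : padicValNat 2 W.shaOrder = padicValNat 2 (Nat.card (AddCommGroup.primaryComponent W.sha 2)) :=
    X11b.Three.Koly.padicValNat_shaOrder_eq W 2
  have hsD : padicValNat 2 Wd.shaOrder = padicValNat 2 (Nat.card (AddCommGroup.primaryComponent Wd.sha 2)) :=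
    X11b.Three.Koly.padicValNat_shaOrder_eq Wd 2
  set e : ℕ := (if W.Δ < 0 then 1 else 0 : ℕ) with he_def
  constructor
  · rintro ⟨q₁, q₁', hq₁, hq₁', hle⟩ m hm
    have h1 : q₁ = q := by
      have : ((q₁ : ℂ)) = (q : ℂ) := by rw [← hq₁, hq]
      exact_mod_cast this
    have h2 : q₁' = q' := by
      have : ((q₁' : ℂ)) = (q' : ℂ) := by rw [← hq₁', hq']
      exact_mod_cast this
    subst h1 h2
    have hv := hval m hm
    rw [hsW, hsD] at hle
    rw [← Nat.cast_le (α := ℤ)]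
    push_cast at hle ⊢
    linarith
  · intro h
    refine ⟨q, q', hq, hq', ?_⟩
    have hv := hval m₀ hm₀
    have hineqZ := (Nat.cast_le (α := ℤ)).mpr (h m₀ hm₀)
    rw [hsW, hsD]
    push_cast at hineqZ ⊢
    linarith

end ESide

/-! ### §3 `p = 2`, K-side, per conductor-`1` datum, PRINT only: the c-corrected one-sided binders ARE the over-`K` halves -/

section KSide

variable (W : WeierstrassCurve ℚ) [W.IsElliptic] [W.IsGloballyMinimal] [NeZero (W.conductorNorm ℤ)]
  (K : Type) [Field K] [NumberField K]
  (Dt : ModularParametrizationData W (W.conductorNorm ℤ)) (β : ℤ) (ι : K →+* ℂ) (d₁ : KolyvaginHeegnerData Dt β ι 1)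
  (hGZ : gross_zagier (W.conductorNorm ℤ) W K)
  (hGZK : rank_eq_analyticRank_of_analyticRank_le_one) (hmod : hasEntireLFunction_rat)
  (hρ : W.HasSurjectiveModNGaloisRep 2) (hT : Odd W.tamagawaProduct)
  (hK : IsImaginaryQuadratic K) (hodd : Odd (NumberField.discr K)) (h3 : NumberField.discr K ≠ -3)
  (hH : SatisfiesHeegnerHypothesis (W.conductorNorm ℤ) K)
  (hrK : (W.baseChange K).analyticRank = 1)

include hGZ hGZK hmod hρ hT hK hodd h3 hH hrK

/-- **The c-corrected UPPER binder IS the UPPER half over `K`, PRINT only.**  `W/ℚ` globally minimal with `ρ̄_{W,2}` onto and odd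
`∏ c_ℓ`; `K` imaginary quadratic with odd `d_K ≠ −3` and the Heegner hypothesis; ANY datum `Dt` (constant `c`); `d₁` a conductor-`1`
Kolyvagin–Heegner datum with `2^{M₀} ∥ P(1)` in `E(K[1])`; `ord_{s=1} L(E_K, s) = 1`; Gross–Zagier, GZK, modularity.  THEN
`AdditivePotMult.MissingUpperBoundOverCAt (W ⊗ K) 2` (`ord₂ #Ш(E_K) ≤ ord₂ #Ш_an(E_K)`) ⟺ **`ord₂ #Ш(E_K)[2^∞] + 2·v₂(c) ≤ 2·M₀`** —
because `ord₂ #Ш_an(W ⊗ K) = 2·M₀ − 2·v₂(c)` (`exists_shaAnOverC_baseChange_padicValRat_eq_C`, p626702).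
[cite: GrossZagier1986, V.§2] [cite: McCallumLMS1991, §5 Lemma 5.1] [cite: GrossLMS1991, Thm. 1.3 and §2 Conj. (2.2)] -/
theorem upperOverC_baseChange_two_iff_shaUpperC_at {M₀ : ℕ}
    (hdiv : ∃ Q : (W.baseChange (ringClassField K ι 1)).toAffine.Point, ((2 ^ M₀ : ℕ) : ℤ) • Q = d₁.derivedPoint)
    (hndiv : ¬ ∃ Q : (W.baseChange (ringClassField K ι 1)).toAffine.Point, ((2 ^ (M₀ + 1) : ℕ) : ℤ) • Q = d₁.derivedPoint) :
    MissingUpperBoundOverCAt (W.baseChange K) 2 ↔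
      (padicValNat 2 (Nat.card (AddCommGroup.primaryComponent (W.baseChange K).sha 2)) : ℤ) + 2 * padicValInt 2 Dt.c ≤ 2 * M₀ := by
  obtain ⟨-, hshaV, q, hq, hval⟩ := exists_shaAnOverC_baseChange_padicValRat_eq_C W K Dt β ι d₁ hGZ hGZK hmod hρ hT hK hodd h3 hH
    hrK hdiv hndiv
  constructor
  · rintro ⟨q₁, hq₁, hle⟩
    have h1 : q₁ = q := by
      have : ((q₁ : ℂ)) = (q : ℂ) := by rw [← hq₁, hq]
      exact_mod_cast this
    subst h1
    rw [hshaV, hval] at hle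
    linarith
  · intro h
    exact ⟨q, hq, by rw [hshaV, hval]; linarith⟩

/-- **The c-corrected LOWER binder IS the LOWER half over `K`, PRINT only**: `MissingLowerBoundOverCAt (W ⊗ K) 2` ⟺
**`2·M₀ ≤ ord₂ #Ш(E_K)[2^∞] + 2·v₂(c)`**, same setting. [cite: GrossZagier1986, V.§2] [cite: GrossLMS1991, §2 Conj. (2.2)] -/
theorem lowerOverC_baseChange_two_iff_shaLowerC_at {M₀ : ℕ}
    (hdiv : ∃ Q : (W.baseChange (ringClassField K ι 1)).toAffine.Point, ((2 ^ M₀ : ℕ) : ℤ) • Q = d₁.derivedPoint)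
    (hndiv : ¬ ∃ Q : (W.baseChange (ringClassField K ι 1)).toAffine.Point, ((2 ^ (M₀ + 1) : ℕ) : ℤ) • Q = d₁.derivedPoint) :
    MissingLowerBoundOverCAt (W.baseChange K) 2 ↔
      2 * (M₀ : ℤ) ≤ (padicValNat 2 (Nat.card (AddCommGroup.primaryComponent (W.baseChange K).sha 2)) : ℤ) + 2 * padicValInt 2 Dt.c := by
  obtain ⟨-, hshaV, q, hq, hval⟩ := exists_shaAnOverC_baseChange_padicValRat_eq_C W K Dt β ι d₁ hGZ hGZK hmod hρ hT hK hodd h3 hH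
    hrK hdiv hndiv
  constructor
  · rintro ⟨q₁, hq₁, hle⟩
    have h1 : q₁ = q := by
      have : ((q₁ : ℂ)) = (q : ℂ) := by rw [← hq₁, hq]
      exact_mod_cast this
    subst h1
    rw [hshaV, hval] at hle
    linarith
  · intro h
    exact ⟨q, hq, by rw [hshaV, hval]; linarith⟩

end KSide

/-! ### §4 Doors are Kolyvagin-admissible, and every door of a rank-one curve carries a conductor-`1` Kolyvagin–Heegner datum -/

/-- A rational of odd `p`-adic valuation is not a square. [folklore] -/
private theorem not_isSquare_of_odd_padicValRat (p : ℕ) [Fact p.Prime] {x : ℚ} (hx : x ≠ 0)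
    (hv : Odd (padicValRat p x)) : ¬ IsSquare x := by
  rintro ⟨r, hr⟩
  have hr0 : r ≠ 0 := by
    rintro rfl
    exact hx (by rw [hr, mul_zero])
  rw [hr, padicValRat.mul hr0 hr0] at hv
  exact (Int.not_even_iff_odd.mpr hv) ⟨padicValRat p r, rfl⟩

/-- **A door-admissible discriminant is Kolyvagin-admissible at `2`** (route GenusKolyvaginAtTwo's binders): `d` is odd, `d ≠ −3`
(`d ≡ 1 (mod 8)`), and `d·(−|Δ_W|)`, `d·(−2|Δ_W|)` are non-squares in `ℚ` — a prime `q ∣ d` (`|d| ≥ 7`) is odd and of good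
reduction, so `q ∤ Δ_min` (`not_dvd_minimalDiscriminantInt_of_hasGoodReductionAtPrime'`) and both products have `q`-adic
valuation exactly `1`. [cite: SilvermanAEC2009, VII.5 Prop. 5.1(a)] -/
theorem kolyvaginAdmissible_of_doorAdmissible (W : WeierstrassCurve ℚ) [W.IsElliptic] [W.IsGloballyMinimal] {d : ℤ}
    (hadm : DoorAdmissible W d) :
    Odd d ∧ d ≠ -3 ∧ ¬ IsSquare ((d : ℚ) * -|W.Δ|) ∧ ¬ IsSquare ((d : ℚ) * (-(2 * |W.Δ|))) := by
  obtain ⟨hdneg, hsq, hd8, hgood, -⟩ := hadm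
  have hd0 : d ≠ 0 := hdneg.ne
  refine ⟨Int.odd_iff.mpr (by omega), by omega, ?_⟩
  -- a prime of `d`
  obtain ⟨q, hq, hqd'⟩ : ∃ q : ℕ, q.Prime ∧ q ∣ d.natAbs := Nat.exists_prime_and_dvd (by omega)
  have hqd : (q : ℤ) ∣ d := Int.ofNat_dvd_left.mpr hqd'
  haveI hF : Fact q.Prime := ⟨hq⟩
  have hq2 : q ≠ 2 := by
    rintro rfl
    have : d % 2 = 0 := Int.emod_eq_zero_of_dvd (by exact_mod_cast hqd)
    omega
  have hgoodq : W.HasGoodReductionAtPrime q := hgood q hq hqd hF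
  -- `q ∤ Δ_min`: `v_q(Δ) = 0`, `v_q(d) = 1`, `v_q(2) = 0`
  have hΔmin : ¬ (q : ℤ) ∣ minimalDiscriminantInt W := W.not_dvd_minimalDiscriminantInt_of_hasGoodReductionAtPrime' q hgoodq
  have hΔQ : ((minimalDiscriminantInt W : ℤ) : ℚ) = W.Δ := cast_minimalDiscriminantInt W
  have hΔ : W.Δ ≠ 0 := W.isUnit_Δ.ne_zero
  have hvΔ : padicValRat q W.Δ = 0 := by
    rw [← hΔQ, padicValRat.of_int]
    simp [padicValInt, padicValNat.eq_zero_of_not_dvd (fun h => hΔmin (Int.ofNat_dvd_left.mpr h))]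
  have hvabs : padicValRat q |W.Δ| = 0 := by
    rcases abs_choice W.Δ with h | h
    · rw [h, hvΔ]
    · rw [h, padicValRat.neg, hvΔ]
  have hvd : padicValRat q (d : ℚ) = 1 := by
    rw [padicValRat.of_int]
    have hsq' : Squarefree d.natAbs := Int.squarefree_natAbs.mpr hsq
    have h1 : d.natAbs.factorization q = 1 := Nat.factorization_eq_one_of_squarefree hsq' hq hqd'
    rw [Nat.factorization_def _ hq] at h1
    simp [padicValInt, h1]
  have hv2 : padicValRat q (2 : ℚ) = 0 := by
    have h : ¬ q ∣ 2 := fun h => hq2 ((Nat.prime_dvd_prime_iff_eq hq Nat.prime_two).mp h)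
    rw [show (2 : ℚ) = ((2 : ℕ) : ℚ) by norm_num, padicValRat.of_nat, padicValNat.eq_zero_of_not_dvd h]
    simp
  have hdQ : (d : ℚ) ≠ 0 := by exact_mod_cast hd0
  have habs : |W.Δ| ≠ 0 := abs_ne_zero.mpr hΔ
  have hπ1 : padicValRat q ((d : ℚ) * -|W.Δ|) = 1 := by
    rw [padicValRat.mul hdQ (neg_ne_zero.mpr habs), padicValRat.neg, hvabs, hvd]; norm_num
  have hπ2 : padicValRat q ((d : ℚ) * (-(2 * |W.Δ|))) = 1 := by
    rw [padicValRat.mul hdQ (neg_ne_zero.mpr (mul_ne_zero two_ne_zero habs)), padicValRat.neg,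
      padicValRat.mul two_ne_zero habs, hvabs, hvd, hv2]; norm_num
  exact ⟨not_isSquare_of_odd_padicValRat q (mul_ne_zero hdQ (neg_ne_zero.mpr habs)) (by rw [hπ1]; exact odd_one),
    not_isSquare_of_odd_padicValRat q (mul_ne_zero hdQ (neg_ne_zero.mpr (mul_ne_zero two_ne_zero habs)))
      (by rw [hπ2]; exact odd_one)⟩

/-- **Every door of a rank-one curve carries a conductor-`1` Kolyvagin–Heegner datum with `y_K` of infinite order and an exact
`2`-divisibility exponent** — at a GIVEN imaginary quadratic `K` with the Heegner hypothesis and `L(W^{(d_K)},1) ≠ 0`, for a GIVEN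
datum `Dt` and embedding `ι` (the body of `exists_kolyvaginDoorDatum_of_onSlice`, p627493, without its field choice): `β` from
`d_K ≡ β² (mod 4N)`, `d₁` from the PROVED CM rationality (`exists_kolyvaginHeegnerData_one`), `y_K = P(1)` non-torsion by Gross–Zagier on
`L'(E_K,1) = L'(W,1)·L(W^{(d_K)},1) ≠ 0` and the injectivity of `E(K) → E(K[1])`, `M₀` by finite generation of `E(K[1])`.
[cite: GrossZagier1986, V.§2 (p. 312)] [cite: GrossLMS1991, §4] [cite: Darmon2004, Thm. 3.6] -/
theorem exists_kolyvaginDatum_at_door (hmod : hasEntireLFunction_rat)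
    (W : WeierstrassCurve ℚ) [W.IsElliptic] [W.IsGloballyMinimal] [NeZero (W.conductorNorm ℤ)] (hr : W.analyticRank = 1)
    (K : Type) [Field K] [NumberField K] (hK : IsImaginaryQuadratic K)
    (hGZ : gross_zagier (W.conductorNorm ℤ) W K) (hH : SatisfiesHeegnerHypothesis (W.conductorNorm ℤ) K)
    (hLt : (W.quadraticTwist (NumberField.discr K : ℚ)).entireLFunction 1 ≠ 0)
    (Dt : ModularParametrizationData W (W.conductorNorm ℤ)) (ι : K →+* ℂ) :
    ∃ (β : ℤ) (d₁ : KolyvaginHeegnerData Dt β ι 1) (M₀ : ℕ), ¬ IsOfFinAddOrder d₁.derivedPoint ∧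
      (∃ Q : (W.baseChange (ringClassField K ι 1)).toAffine.Point, ((2 ^ M₀ : ℕ) : ℤ) • Q = d₁.derivedPoint) ∧
      ¬ ∃ Q : (W.baseChange (ringClassField K ι 1)).toAffine.Point, ((2 ^ (M₀ + 1) : ℕ) : ℤ) • Q = d₁.derivedPoint := by
  obtain ⟨β, hβ⟩ : ∃ β : ℤ, (4 * (W.conductorNorm ℤ : ℕ) : ℤ) ∣ β ^ 2 - NumberField.discr K :=
    Literature.NumberTheory.QuadraticFields.Quadratic.exists_dvd_sq_sub_discr_of_ncard_primesOver hK.1 (NeZero.ne _) hH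
  obtain ⟨d₁⟩ := exists_kolyvaginHeegnerData_one
    (phi_heegnerTau_mem_singularModuliField_holds (W.conductorNorm ℤ) W K) hK Dt β ι hβ
  haveI hEK : (W.baseChange K).IsElliptic := isElliptic_baseChange' W K
  have hL0 : W.entireLFunction 1 = 0 := entireLFunction_one_eq_zero_of_analyticRank_eq_one hr
  obtain ⟨-, hderiv⟩ := leadingLCoeff_eq_deriv_of_analyticRank_eq_one hr
  have hLK : LDerivEK W K ≠ 0 := by
    rw [lDerivEK_eq_deriv_mul W K hmod hL0]; exact mul_ne_zero hderiv hLt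
  obtain ⟨P₀, Hd, hP₀, hP₀K⟩ := exists_heegnerPoint_map_eq_derivedPoint_one hK hH d₁
  have hP₀inf : ¬ IsOfFinAddOrder P₀ :=
    (lDerivEK_ne_zero_iff_not_isOfFinAddOrder W (W.conductorNorm ℤ) K hGZ hK hH ⟨Dt, Hd, ι, hP₀⟩).mp hLK
  have hy : ¬ IsOfFinAddOrder d₁.derivedPoint := by
    intro hfin
    apply hP₀inf
    rw [← hP₀K] at hfin
    exact (WeierstrassCurve.Affine.Point.map_injective (W' := W) _).isOfFinAddOrder_iff.mp hfin
  obtain ⟨M₀, hdiv, hndiv⟩ : ∃ M₀ : ℕ,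
      (∃ Q : (W.baseChange (ringClassField K ι 1)).toAffine.Point, ((2 ^ M₀ : ℕ) : ℤ) • Q = d₁.derivedPoint) ∧
      ¬ ∃ Q : (W.baseChange (ringClassField K ι 1)).toAffine.Point, ((2 ^ (M₀ + 1) : ℕ) : ℤ) • Q = d₁.derivedPoint := by
    haveI : NumberField (ringClassField K ι 1) := numberField_ringClassField hK ι one_ne_zero
    haveI : (W.baseChange (ringClassField K ι 1)).IsElliptic := by rw [baseChange]; infer_instance
    haveI : Module.Finite ℤ (W.baseChange (ringClassField K ι 1)).toAffine.Point := by
      convert (W.baseChange (ringClassField K ι 1)).module_finite_point_holds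
    exact exists_pow_smul_eq_and_not_of_not_isOfFinAddOrder Nat.prime_two hy
  exact ⟨β, d₁, M₀, hy, hdiv, hndiv⟩

end Summit.BirchSwinnertonDyer.BirchSwinnertonDyer.Theorems.RankOneAtTwoOneDoor

end
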